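import Literature.MathematicalPhysics.QuantumFieldTheory.Balaban1983to89.B8SockHFPRec
import Literature.MathematicalPhysics.QuantumFieldTheory.Balaban1983to89.B8SockHFPWindowsRec
import Literature.MathematicalPhysics.QuantumFieldTheory.Balaban1983to89.B8Prop6DentedCubeMemberGammaRec
import Literature.MathematicalPhysics.QuantumFieldTheory.Balaban1983to89.B8SockHFPDentedCubeMemberRec
import Literature.MathematicalPhysics.QuantumFieldTheory.Balaban1983to89.B8Eq191FlatLettersDentedCubeMemberRec
import Literature.MathematicalPhysics.QuantumFieldTheory.Balaban1983to89.B8Eq191FlatLettersRDOfRealRec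
import Literature.MathematicalPhysics.QuantumFieldTheory.Balaban1983to89.B8Real123FlatTranslateRec
import Literature.MathematicalPhysics.QuantumFieldTheory.Balaban1983to89.B8Ineq159FlatOfScalarBdryBetaRec
import Literature.MathematicalPhysics.QuantumFieldTheory.Balaban1983to89.B8Prop6DentedCubeMemberFlatScalarGamma

/-!
# `Balaban1983to89.B8Prop6DentedCubeMemberFlatScalarGammaRec` — RECORD TWIN of `B8Prop6DentedCubeMemberFlatScalarGamma` ([Balaban1985RegularSpaces] Prop. 6 p. 99, EXISTENCE HALF, at the
# dented cube member, edition γ: from three REAL inequality families on the explicit flat Dirichlet matrices + Theorem 4's (1.59) clause at background 1 ∕ its scalar flat form)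
# FOR THE SYMMETRISED CENTRED block averaging (0.4) of [Balaban1987RG1] — item R6 (g)-4 of the record crown (desk `R6-PLAN.md` §5)

statement-level skeleton of published theorems with citation tags; proofs where landed; nothing here is a claim about the Yang–Mills mass gap

T. Bałaban, *Spaces of regular gauge field configurations on a lattice and gauge fixing conditions*, Commun. Math. Phys. **99** (1985) 75–102
`[Balaban1985RegularSpaces]` ("[6]"): Prop. 6 p. 99, Thm 4 p. 88, Prop. 5 (1.106)–(1.109) p. 94, Prop. 3 p. 87, (1.92) p. 91, (1.98) p. 92, (1.101) p. 93, (1.59) p. 86, (1.31) p. 82;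
T. Bałaban, *Propagators for lattice gauge theories in a background field*, Commun. Math. Phys. **99** (1985) 389–434 `[Balaban1985BackgroundPropagators]` ("[4]"): Thms 3.1–3.3
pp. 397–399; T. Bałaban, *The variational problem and background fields in renormalization group method for lattice gauge theories*, Commun. Math. Phys. **102** (1985) 277–309
`[Balaban1985Variational]` ("[15]"): (148)–(150) p. 301; T. Bałaban, *Renormalization group approach to lattice gauge field theories. I*, Commun. Math. Phys. **109** (1987) 249–301
`[Balaban1987RG1]` ("[I]"): (0.3)–(0.4) pp. 252–253.  STATUS: published, refereed.

CITATION HEADER (lean-in-tree rule).  Cell `pub-ymgap`, «N05-REC» stage 2 (director-ym №254∕№255∕№288), item R6 (g)-4 — typed by the LEAD PEN dag-n05-e g39 (inventory `N05-REC-INVENTORY.md` §R6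
row `B8Prop6DentedCubeMemberFlatScalarGamma`: A `prop6_dentedMember_flat_of_real_γ`; + `prop6_dentedMember_flat_of_scalar_γ`).  WHAT IS REPRODUCED = ✓ the engine module (seat
`pub-ymgap-dag-n05-e` g31∕g32) VERBATIM under the token map, the REAL premise packaged as g38's `B8Real123FlatTranslateRec.Real123Block L (flmZ L) η n w c.sq (c.lamST n) …`
(CENTRED labels).  THEOREM NAMES = the engine's (namespace `…B8Prop6DentedCubeMemberFlatScalarGammaRec`).  TOKEN MAP: `CubeB8D ↦ Node00.CubeB8DZ`, `cutFixed ∕ localGauge ∕ Restr129 ∕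
IsLandau138W ∕ IsLandau138 ∕ linCovIter ∕ QT ↦ cutFixedZ ∕ localGaugeZ ∕ Restr129Z ∕ IsLandau138WZ ∕ IsLandau138Z ∕ linCovIterZ ∕ QTZ`, `blockMap (Lʲ) ↦ flmZ L j`, `C0 ↦ C0Z`, regime
`(hL : 2 ≤ L) ↦ (hLs : L = 2sL+1) (hs1 : 1 ≤ sL)`; the (1.61) remainder constant and the [3] windows in record form (`B8SockHFPWindowsRec.hfpWindowsZ_of_guard`, g38's
`B8Thm4ExistsAtGammaRec.thm4_windowsZ_γ`; `16(L·c⋆) ≤ 1` now from `1024·d·KZ·c_B ≤ 1`, `KZ ≥ 2`).  Record inputs: g38's (g) root `B8Prop6DentedCubeMemberGammaRec.thm4_hypotheses_one_cutFixed_dented_γ ∕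
prop6_exists_dentedMember_at_γ₃` and (g)-0 `B8DentedCubeMemberZdRec.hΩ_sq ∕ lamBPT_hbox_pred ∕ lamBPT_hclass ∕ bdryLayer_dented`, dag-n07-w3's side files `B8SockHFPDentedCubeMemberRec.htw_lamST ∕
h8lt_lamST ∕ h8top_lamST` (p728351) and `B8Eq191FlatLettersDentedCubeMemberRec.lamST_finite ∕ sq_zero_finite ∕ sq_subset_zero ∕ tower_meets_dented ∕ towers_disjoint_dented` (p728372), g38's R6-8
`B8Eq191FlatLettersRDOfRealRec.flatLettersZRD_of_real` and R6-9 `B8Ineq159FlatOfScalarBdryBetaRec.flat159Z_clause_of_scalar_bdryβ`, dag-n05-c's `B8Prop5KLevelLettersRec.hP5base_of_HFP ∕ hP5_of_HFP`,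
this seat's `B8SockHFPRec.sockHFP₀_body_of_join_RD ∕ sockHFP_body_of_join_59_γ` and `B8SockHFPWindowsRec.hfpWindowsZ_of_guard`; structure-free `B8Eq191FlatLettersDirichlet.exists_towerFinset`.
Kind «kernel-checked proof», theorems only; no `def`, no `instance`, no `notation`, no existing module modified.  `--supports stmt-QuantumFields-20541` (K0⁷-keyed, COUNT-NEUTRAL).

## WHAT IS CERTIFIED HERE (kernel; axioms `propext` ∕ `Classical.choice` ∕ `Quot.sound`)
* `prop6_dentedMember_flat_of_real_γ` — Prop. 6 (existence half) at the dented RECORD member from the three REAL families (`Real123Block`, centred labels) and Theorem 4's two-member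
  (1.59) clause `H59D₁` at background `1` (record letters), threshold `min (min c₀ c_P) c₃`.
* `prop6_dentedMember_flat_of_scalar_γ` — the same with `H59D₁` replaced by the SCALAR flat (1.59) γ clause (record `IsLandau138Z`, `linCovIterZ`), via R6-9's `⊗ id` transfer.

HONEST SCOPE: the engine's proof verbatim under the token map; nothing of Bałaban's analysis newly proved; the three REAL families and the (1.59) clause stay displayed (discharged two files
down by g38's unconditional Z facts); `HThm4Rec` UNDISCHARGED; caveat (C-S3-1) + addendum v4 stand; N05 [B8] DISCHARGED OF RECORD untouched; N05 ∕ N07 NOT discharged; COUNT of record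
unmoved · K numerically unchanged; one finite `𝕋⁴` programme at fixed `ε`, Bałaban AS PRINTED; nothing continuum ∕ ℝ⁴ ∕ OS ∕ mass-gap ∕ Clay.  No `sorry`, no `def`.

[cite: Balaban1985RegularSpaces, Prop. 6 p.99, Theorem 4 p.88, Prop. 5 (1.106)–(1.109) p.94, Prop. 3 p.87, (1.92) p.91, (1.98) p.92, (1.101) p.93, (1.59) p.86, (1.31) p.82;
Balaban1985BackgroundPropagators, Theorems 3.1–3.3 pp.397–399; Balaban1985Variational, (148)–(150) p.301; Balaban1987RG1, (0.3)–(0.4) pp.252–253]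
-/

noncomputable section

open NormedSpace
open scoped BigOperators

namespace Literature.MathematicalPhysics.QuantumFieldTheory.Balaban1983to89.B8Prop6DentedCubeMemberFlatScalarGammaRec

open Complex (I)
open B7Prop1Explicit B7Prop2Explicit B7Prop1Local B7Eq92Concrete
open B7Prop2Explicit (c2')
open B7Prop2Rec (C0Z)
open B7Prop4GeneralLevelsRec (cZ gZ KZ gZ_nonneg)
open B7Prop3Flat (c3)
open B7Prop10General (C6)
open B8Ineq132 (covDerivFwd InAk BondTouches)
open B8Ineq133Rec (cutFixedZ)
open B8Eq115GaugeFixingRec (localGaugeZ)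
open B8Eq119TwistedAxialRec (Restr129Z)
open B8Eq184Proof (gaugeExp cfgExp)
open B8Lemma1NonAbelian (mulCfg)
open B8Eq140Level (SideTouches)
open B8Eq146AExpansion (iEta)
open B7SectEFLinearisationRec (linCovIterZ)
open B8Eq155JBound (Jcur wsup)
open B8ScaledSupNorm (bondNorm msup)
open B8Eq138LandauZd (logCfg covLap)
open B8Eq138LandauZdRec (IsLandau138WZ IsLandau138Z QTZ)
open B8Eq1117Concrete (XSpace)
open B8Prop5ContractionKLevel (Bd2)
open B8LambdaSpaceKLevel (wt)
open B8Eq131Cubes (tLo tHi ctr)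
open B8Ineq130Rec (tlo thi)
open B8Eq119TwistedAxialRec (flmZ)
open B8Prop6DentedCubeMemberGammaRec (thm4_hypotheses_one_cutFixed_dented_γ prop6_exists_dentedMember_at_γ₃)
open B8DentedCubeMemberZdRec (hΩ_sq lamBPT_hbox_pred lamBPT_hclass bdryLayer_dented)
open B8Thm4ExistsAtGammaRec (thm4_windowsZ_γ)
open B9SupplySockB9P3ZdBeta (CrossB)
open B8SockHFPWindowsRec (hfpWindowsZ_of_guard)
open B7ConclGaugeLin (two_le_C6')
open B8SockHFPRec (sockHFP₀_body_of_join_RD sockHFP_body_of_join_59_γ)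
open B8SockHFPDentedCubeMemberRec (htw_lamST h8lt_lamST h8top_lamST)
open B8Prop5KLevelLettersRec (hP5base_of_HFP hP5_of_HFP)
open B8Eq191FlatLettersDirichlet (exists_towerFinset)
open B8Eq191FlatLettersDentedCubeMemberRec (lamST_finite sq_zero_finite sq_subset_zero tower_meets_dented towers_disjoint_dented)
open Node00 (CubeB8DZ)
open B8Eq191FlatLettersRDOfRealRec (flatLettersZRD_of_real)
open B8Real123FlatTranslateRec (Real123Block)
open B8Ineq159FlatOfScalarBdryBetaRec (flat159Z_clause_of_scalar_bdryβ)

export B7Prop1Explicit (Site)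

variable {d : ℕ}

variable {𝔸 : Type} [CStarAlgebra 𝔸] [Nontrivial 𝔸]

/-! ## Proposition 6 at the cube member from three real inequality families and the REPAIRED (1.59) clause for `G(1)` -/

open Classical in
/-- ★★ **PROPOSITION 6 (p. 99), EXISTENCE HALF, AT THE DENTED CUBE MEMBER (`CubeB8D`, [15] (148)–(150)) FROM THREE REAL INEQUALITY FAMILIES AND THEOREM 4's (1.59) CLAUSE
`H59Dβ₁` AT BACKGROUND `1`, EDITION γ** — g8's `prop6_cubeMember_flat_of_real_bdryβ` (p553065) with the (1.59) clause's averaging index over the split print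
class `cubeLamBP' … m j ∪ {level-0 crossing bonds of □₀}`; the three REAL families VERBATIM ((1.101) for `T⁻¹`, (1.92)+`Δ`-entry for `T⁻¹(T⁻¹Qᵀ)(QT⁻¹T⁻¹Qᵀ)⁻¹`,
(1.98) for `1 − T⁻¹Qᵀ(QT⁻¹T⁻¹Qᵀ)⁻¹QT⁻¹`, real lattice functions, Dirichlet on `□₀`); Proposition 5's base from the REAL letters (`sockHFP₀_body_of_join_RD`,
unchanged), its step from `B8SockHFP59Gamma.sockHFP_body_of_join_59_γ` with the five γ windows derived here from `thm4_windows_γ`; assembled by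
`B8Prop6CubeMemberFlat3Gamma.prop6_exists_cubeMember_at_γ₃`.  Threshold `min (min c₀ c_P) c₃`.
[cite: Balaban1985RegularSpaces, Prop. 6 p.99, Thm 4 p.88, Prop. 5 (1.106)–(1.109) p.94, Prop. 3 p.87, (1.92) p.91, (1.98) p.92, (1.101) p.93, (1.59) p.86, (1.31) p.82; Balaban1985BackgroundPropagators, Thms 3.1–3.3 pp.397–399] -/
theorem prop6_dentedMember_flat_of_real_γ (hd2 : 2 ≤ d) {L sL : ℕ} (hLs : L = 2 * sL + 1) (hs1 : 1 ≤ sL) {B₀ B₀' B₀'H B₂' BG BR : ℝ} (hB₀ : 0 < B₀) (hB₀' : 0 < B₀')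
    (hB : 2 ≤ 5 * (d : ℝ) * L * B₀) (hB₀'H : 0 < B₀'H) (hB₂' : 0 ≤ B₂') (hBG : 0 ≤ BG) (hBR : 0 ≤ BR)
    (hfree : 3 * (2 * (d : ℝ) * (L : ℝ) ^ 2) * BG * BR ≤ B₀') {Bbd : ℝ} (hBbd : 0 ≤ Bbd) (hBd : 4 * Bbd ≤ ((d : ℝ) * L - 1) * B₀) :
    ∃ c₁ : ℝ, 0 < c₁ ∧ ∀ (η : ℝ), 0 < η → ∀ {K : ℕ} {Ω : ℕ → Set (Site d)} (c : CubeB8DZ d L K Ω),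
      ∀ (U₀ : Site d → Fin d → 𝔸ˣ), (∀ x κ, U₀ x κ ∈ unitaryUnits 𝔸) → ∀ (α₀ : ℝ), 0 < α₀ →
      C0Z d * (α₀ * (L : ℝ) ^ 2) ≤ 1 / 3 → 2 * (α₀ * (L : ℝ) ^ 2) ≤ c2' d L →
      InAk L c.k η α₀ Ω U₀ →
      11 * (d : ℝ) ^ 2 * (L : ℝ) ^ 2 * α₀ + ((c.M : ℝ) + 4 * c.ρ) * d * (L : ℝ) ^ 2 * α₀ ≤ 1 / 6 →
      (L : ℝ) ^ 3 * α₀ + 6 * d * (L : ℝ) ^ 2 * c.M * α₀ ≤ c₁ →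
      -- the weights of `Q′ᵀaQ′` (free, nonnegative) and THE THREE REAL INEQUALITY FAMILIES at every truncation `n ≤ k` on the explicit matrices,
      -- CENTRED labels `flmZ` (g38's `B8Real123FlatTranslateRec.Real123Block`)
      ∀ (w : ℕ → ℝ), (∀ j, 0 ≤ w j) →
      (∀ n, 1 ≤ n → n ≤ c.k → Real123Block L (flmZ L) η n w c.sq (c.lamST n) BG B₀'H B₂' BR) →
      -- (1.59) for `G(1)` IN THE REPAIRED CURRENCY — Theorem 4's two-member clause at background `1` with the support clause and the
      -- exterior-collar allowance (VERBATIM `B8Prop6CubeMemberFlat3Bdry`'s `H59D₁`)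
      ((∀ m, 1 ≤ m → m ≤ c.k → ∀ (u : Site d → 𝔸ˣ) (W : Site d → Fin d → 𝔸ˣ) (A' : Site d → Fin d → 𝔸),
        (∀ x, u x ∈ unitaryUnits 𝔸) → (∀ x, x ∉ c.sq 0 → u x = 1) →
          mgauge (1 : Site d → Fin d → 𝔸ˣ) u W = (cutFixedZ L (tLo c.a c.ρ) (tHi c.a c.M c.ρ) U₀ c.k (ctr c.a c.M)) →
          Restr129Z L m (c.lamST m) (1 : Site d → Fin d → 𝔸ˣ) u →
          IsLandau138WZ L m η (c.sq 0) (c.lamST m) (1 : Site d → Fin d → 𝔸ˣ) W →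
        (∀ y τ, IsSelfAdjoint (A' y τ)) →
        (∀ j, j ≤ m → ∀ y τ, SideTouches (c.sq j) y τ →
        W y τ = cfgExp η A' y τ ∧
          ‖A' y τ‖ ≤ (2 * (L * (5 * (d : ℝ) * L * B₀ * (((L : ℝ) ^ 3 * α₀) + (6 * d * (L : ℝ) ^ 2 * c.M * α₀)))) + 8 * (8 * B₀' * (5 * (d : ℝ) * L * B₀) * (((L : ℝ) ^ 3 * α₀) + (6 * d * (L : ℝ) ^ 2 * c.M * α₀)))) * ((L : ℝ) ^ j * η)⁻¹) →
        (∀ y τ, (∀ j, j ≤ m → ¬ SideTouches (c.sq j) y τ) → A' y τ = 0) →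
        msup L m η (-(1 : ℝ)) (fun j (b : Site d × Fin d) => SideTouches (c.sq j) b.1 b.2) (fun b => A' b.1 b.2)
        ≤ B₀ * (bondNorm L m η (-(3 : ℝ)) c.sq (fun x μ => Jcur η (1 : Site d → Fin d → 𝔸ˣ) A' μ x)
        + wsup 1 (fun p : {p : ℕ × (Site d × Fin d) // p.1 ≤ m ∧ (p.2 ∈ c.lamBPT m p.1 ∨ (p.1 = 0 ∧ CrossB (c.sq 0) p.2))} =>
        linCovIterZ L (1 : Site d → Fin d → 𝔸ˣ) (iEta η A') p.1.1 p.1.2.1 p.1.2.2))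
        + Bbd * msup L m η (-(1 : ℝ)) (fun j (b : Site d × Fin d) => j = 0 ∧ SideTouches (c.sq 0) b.1 b.2 ∧
            ¬ BondTouches (c.sq 0) b.1 b.2) (fun b => A' b.1 b.2) ∧
        msup L m η (-(2 : ℝ)) (fun j (t : Fin d × Fin d × Site d) => SideTouches (c.sq j) t.2.2 t.2.1)
        (fun t => covDerivFwd η (1 : Site d → Fin d → 𝔸ˣ) t.1 (fun z => A' z t.2.1) t.2.2)
        ≤ B₀ * (bondNorm L m η (-(3 : ℝ)) c.sq (fun x μ => Jcur η (1 : Site d → Fin d → 𝔸ˣ) A' μ x)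
        + wsup 1 (fun p : {p : ℕ × (Site d × Fin d) // p.1 ≤ m ∧ (p.2 ∈ c.lamBPT m p.1 ∨ (p.1 = 0 ∧ CrossB (c.sq 0) p.2))} =>
        linCovIterZ L (1 : Site d → Fin d → 𝔸ˣ) (iEta η A') p.1.1 p.1.2.1 p.1.2.2))
        + Bbd * msup L m η (-(1 : ℝ)) (fun j (b : Site d × Fin d) => j = 0 ∧ SideTouches (c.sq 0) b.1 b.2 ∧
            ¬ BondTouches (c.sq 0) b.1 b.2) (fun b => A' b.1 b.2))) →
      ∃ u : Site d → 𝔸ˣ, (∀ x, u x ∈ unitaryUnits 𝔸) ∧ (∀ x, x ∉ c.sq 0 → u x = 1) ∧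
        Restr129Z L c.k c.lamS (1 : Site d → Fin d → 𝔸ˣ) u ∧
        IsLandau138WZ L c.k η (c.sq 0) c.lamS (1 : Site d → Fin d → 𝔸ˣ)
          (gaugeAct u⁻¹ (cutFixedZ L (tLo c.a c.ρ) (tHi c.a c.M c.ρ) U₀ c.k (ctr c.a c.M))) ∧
        (∀ j, j ≤ c.k → ∀ b ∈ {b : Site d × Fin d | SideTouches (c.sq j) b.1 b.2},
          gaugeAct u⁻¹ (cutFixedZ L (tLo c.a c.ρ) (tHi c.a c.M c.ρ) U₀ c.k (ctr c.a c.M)) b.1 b.2 =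
              cfgExp η (logCfg η (gaugeAct u⁻¹ (cutFixedZ L (tLo c.a c.ρ) (tHi c.a c.M c.ρ) U₀ c.k (ctr c.a c.M)))) b.1 b.2 ∧
            IsSelfAdjoint (logCfg η (gaugeAct u⁻¹ (cutFixedZ L (tLo c.a c.ρ) (tHi c.a c.M c.ρ) U₀ c.k (ctr c.a c.M))) b.1 b.2) ∧
            ‖logCfg η (gaugeAct u⁻¹ (cutFixedZ L (tLo c.a c.ρ) (tHi c.a c.M c.ρ) U₀ c.k (ctr c.a c.M))) b.1 b.2‖ ≤
              (5 * (d : ℝ) * L * B₀ * ((L : ℝ) ^ 3 * α₀ + 6 * d * (L : ℝ) ^ 2 * c.M * α₀)) * ((L : ℝ) ^ j * η)⁻¹) ∧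
        (∀ x, ((localGaugeZ L (tLo c.a c.ρ) (tHi c.a c.M c.ρ) U₀ c.k (ctr c.a c.M))⁻¹ * u) x ∈ unitaryUnits 𝔸) ∧
        AgreeOn (tlo L (tLo c.a c.ρ) c.k) (thi L (tHi c.a c.M c.ρ) c.k)
          (gaugeAct ((localGaugeZ L (tLo c.a c.ρ) (tHi c.a c.M c.ρ) U₀ c.k (ctr c.a c.M))⁻¹ * u)⁻¹ U₀)
          (gaugeAct u⁻¹ (cutFixedZ L (tLo c.a c.ρ) (tHi c.a c.M c.ρ) U₀ c.k (ctr c.a c.M))) := by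
  have hL1 : 1 ≤ L := by omega
  have hL : 2 ≤ L := by omega
  have hLo : Odd L := ⟨sL, hLs⟩
  have hd1 : 1 ≤ d := le_trans (by norm_num) hd2
  have hd0 : 0 < d := hd1
  have hLr : (1 : ℝ) ≤ L := by exact_mod_cast hL1
  have hdr : (1 : ℝ) ≤ d := by exact_mod_cast hd1
  have hC6 : (2 : ℝ) ≤ C6 d := two_le_C6'
  obtain ⟨c₀, hc₀, P6⟩ := prop6_exists_dentedMember_at_γ₃ (𝔸 := 𝔸) hd2 hLs hs1 hB₀ hB₀' hB hBbd hBd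
  obtain ⟨cP, hcP, WIN⟩ := hfpWindowsZ_of_guard hd1 hL1 hB₀ hB₀' hB hB₀'H hB₂' hBG hBR one_pos hfree
  obtain ⟨c₃, hc₃γ0, WINγ⟩ := thm4_windowsZ_γ hd1 hL1 hB₀ hB₀'
  refine ⟨min (min c₀ cP) c₃, lt_min (lt_min hc₀ hcP) hc₃γ0, ?_⟩
  intro η hη K Ω c U₀ hU₀ α₀ hα hα3 hα2 hA hsmall hc w hw REAL H59
  simp only [Real123Block] at REAL
  have hk : 1 ≤ c.k := c.one_le_k
  have hρL : L ≤ c.ρ := c.L_le_ρ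
  have hρM : c.ρ ≤ c.M := c.ρ_le_M
  have hc0 : (L : ℝ) ^ 3 * α₀ + 6 * d * (L : ℝ) ^ 2 * c.M * α₀ ≤ c₀ := hc.trans ((min_le_left _ _).trans (min_le_left _ _))
  have hcP' : (L : ℝ) ^ 3 * α₀ + 6 * d * (L : ℝ) ^ 2 * c.M * α₀ ≤ cP := hc.trans ((min_le_left _ _).trans (min_le_right _ _))
  have hc3' : (L : ℝ) ^ 3 * α₀ + 6 * d * (L : ℝ) ^ 2 * c.M * α₀ ≤ c₃ := hc.trans (min_le_right _ _)
  have hρ : 1 ≤ c.ρ := hL1.trans hρL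
  have hM1 : 1 ≤ c.M := hρ.trans hρM
  have hLpos : (0 : ℝ) < L := by positivity
  have hMpos : (0 : ℝ) < c.M := by exact_mod_cast hM1
  have hdpos : (0 : ℝ) < d := by exact_mod_cast hd0
  have hα₀' : 0 < (L : ℝ) ^ 3 * α₀ := by positivity
  have hα₁' : 0 < 6 * (d : ℝ) * (L : ℝ) ^ 2 * c.M * α₀ := by positivity
  -- the pair `(1, U₀″)` at the member
  obtain ⟨hmem, h33, h34, hAx, h135, h66⟩ :=
    thm4_hypotheses_one_cutFixed_dented_γ hLs hs1 hd1 c U₀ hU₀ hα hα3 hα2 hη hA hsmall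
  have hone : ∀ x κ, (1 : Site d → Fin d → 𝔸ˣ) x κ ∈ unitaryUnits 𝔸 := fun _ _ => (unitaryUnits 𝔸).one_mem
  -- the windows at `(α₀, α₁) := (L³α₀, 6dL²Mα₀)`
  obtain ⟨hside, -, -, hsmall₁, -, -, hα3', hα4', hsmallW, hc₃, hsc, hα₃', hs₁, hs₂, hs₃, hs₄, hs₅, hs₆, hs₇, hsm, hprod8, hcA',
    ha₁', hb₁', hθ, h103, h106⟩ := WIN _ _ hα₀' hα₁' hcP' _ _ _ _ _ _ _ _ rfl rfl rfl rfl rfl rfl rfl rfl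
  -- EDITION γ: [3] Prop. 4's windows one level lower and the (1.61) window with `C₂ := 16·131072(d+1)²·L²`, read at `α₂ := c⋆ ≤ 2(L c⋆) + 8α₄`
  obtain ⟨g5, g6, g9, g10, g13, g14⟩ := WINγ _ _ hα₀' hα₁' hc3' _ _ rfl rfl
  -- smallness read by the plain-currency bridges: `α₄ ≤ 1/84`, `c⋆ ≤ 1/12`, `a ≤ 1/4`, `2a ≤ c⋆`
  have hsum0 : 0 ≤ (L : ℝ) ^ 3 * α₀ + 6 * d * (L : ℝ) ^ 2 * c.M * α₀ := by positivity
  have hcs0 : 0 ≤ 5 * (d : ℝ) * L * B₀ * ((L : ℝ) ^ 3 * α₀ + 6 * d * (L : ℝ) ^ 2 * c.M * α₀) := by positivity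
  have hα₄0 : 0 ≤ 8 * B₀' * (5 * (d : ℝ) * L * B₀) * ((L : ℝ) ^ 3 * α₀ + 6 * d * (L : ℝ) ^ 2 * c.M * α₀) := by positivity
  have hs84 : 8 * B₀' * (5 * (d : ℝ) * L * B₀) * ((L : ℝ) ^ 3 * α₀ + 6 * d * (L : ℝ) ^ 2 * c.M * α₀) ≤ 1 / 84 := by
    have h := mul_le_mul_of_nonneg_right hC6 (mul_nonneg (by norm_num : (0 : ℝ) ≤ 2) hα₄0)
    nlinarith only [hs₁, h, hα₄0]
  have hcs12 : 5 * (d : ℝ) * L * B₀ * ((L : ℝ) ^ 3 * α₀ + 6 * d * (L : ℝ) ^ 2 * c.M * α₀) ≤ 1 / 12 := by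
    have h1 : 5 * (d : ℝ) * L * B₀ * ((L : ℝ) ^ 3 * α₀ + 6 * d * (L : ℝ) ^ 2 * c.M * α₀) ≤
        L * (5 * (d : ℝ) * L * B₀ * ((L : ℝ) ^ 3 * α₀ + 6 * d * (L : ℝ) ^ 2 * c.M * α₀)) := le_mul_of_one_le_left hcs0 hLr
    have h2 : L * (5 * (d : ℝ) * L * B₀ * ((L : ℝ) ^ 3 * α₀ + 6 * d * (L : ℝ) ^ 2 * c.M * α₀)) ≤
        d * (L * (5 * (d : ℝ) * L * B₀ * ((L : ℝ) ^ 3 * α₀ + 6 * d * (L : ℝ) ^ 2 * c.M * α₀))) :=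
      le_mul_of_one_le_left (mul_nonneg hLpos.le hcs0) hdr
    have hK2 : (2 : ℝ) ≤ KZ d L := by have h := gZ_nonneg d L; show (2 : ℝ) ≤ 2 * (1 + 2 * gZ d L); linarith only [h]
    have h3 : (d : ℝ) * (L * (5 * (d : ℝ) * L * B₀ * ((L : ℝ) ^ 3 * α₀ + 6 * d * (L : ℝ) ^ 2 * c.M * α₀))) * 2 ≤
        (d : ℝ) * (L * (5 * (d : ℝ) * L * B₀ * ((L : ℝ) ^ 3 * α₀ + 6 * d * (L : ℝ) ^ 2 * c.M * α₀))) * KZ d L :=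
      mul_le_mul_of_nonneg_left hK2 (by positivity)
    linarith only [h1, h2, h3, hsc]
  have ha : 6 * (d : ℝ) * (L : ℝ) ^ 2 * c.M * α₀ ≤ 1 / 4 := by
    have h1 : 6 * (d : ℝ) * (L : ℝ) ^ 2 * c.M * α₀ ≤ (d : ℝ) * L * (6 * (d : ℝ) * (L : ℝ) ^ 2 * c.M * α₀) := by
      have hdL : (1 : ℝ) ≤ (d : ℝ) * L := one_le_mul_of_one_le_of_one_le hdr hLr
      exact le_mul_of_one_le_left hα₁'.le hdL
    linarith only [h1, hsmall₁]
  have ha2 : 2 * (6 * (d : ℝ) * (L : ℝ) ^ 2 * c.M * α₀) ≤ 5 * (d : ℝ) * L * B₀ * ((L : ℝ) ^ 3 * α₀ + 6 * d * (L : ℝ) ^ 2 * c.M * α₀) := by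
    have h1 : 2 * (6 * (d : ℝ) * (L : ℝ) ^ 2 * c.M * α₀) ≤ 2 * ((L : ℝ) ^ 3 * α₀ + 6 * d * (L : ℝ) ^ 2 * c.M * α₀) := by linarith only [hα₀']
    exact h1.trans (mul_le_mul_of_nonneg_right hB hsum0)
  -- the γ windows at `α₂ := c⋆` (monotone in `c⋆ ≤ 2(L c⋆) + 8α₄`)
  have hcsw : 5 * (d : ℝ) * L * B₀ * ((L : ℝ) ^ 3 * α₀ + 6 * d * (L : ℝ) ^ 2 * c.M * α₀) ≤
      2 * (L * (5 * (d : ℝ) * L * B₀ * ((L : ℝ) ^ 3 * α₀ + 6 * d * (L : ℝ) ^ 2 * c.M * α₀)))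
        + 8 * (8 * B₀' * (5 * (d : ℝ) * L * B₀) * ((L : ℝ) ^ 3 * α₀ + 6 * d * (L : ℝ) ^ 2 * c.M * α₀)) := by
    have h1 : 5 * (d : ℝ) * L * B₀ * ((L : ℝ) ^ 3 * α₀ + 6 * d * (L : ℝ) ^ 2 * c.M * α₀) ≤
        L * (5 * (d : ℝ) * L * B₀ * ((L : ℝ) ^ 3 * α₀ + 6 * d * (L : ℝ) ^ 2 * c.M * α₀)) := le_mul_of_one_le_left hcs0 hLr
    linarith only [h1, hcs0, hα₄0]
  have hLcsw := mul_le_mul_of_nonneg_left hcsw hLpos.le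
  have h16γ : 16 * ((L : ℝ) * (5 * (d : ℝ) * L * B₀ * ((L : ℝ) ^ 3 * α₀ + 6 * d * (L : ℝ) ^ 2 * c.M * α₀))) ≤ 1 := by
    have hK2 : (2 : ℝ) ≤ KZ d L := by have h := gZ_nonneg d L; show (2 : ℝ) ≤ 2 * (1 + 2 * gZ d L); linarith only [h]
    have h0 : 0 ≤ (L : ℝ) * (5 * (d : ℝ) * L * B₀ * ((L : ℝ) ^ 3 * α₀ + 6 * d * (L : ℝ) ^ 2 * c.M * α₀)) := by positivity
    have h1 : (L : ℝ) * (5 * (d : ℝ) * L * B₀ * ((L : ℝ) ^ 3 * α₀ + 6 * d * (L : ℝ) ^ 2 * c.M * α₀)) * 2 ≤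
        (L : ℝ) * (5 * (d : ℝ) * L * B₀ * ((L : ℝ) ^ 3 * α₀ + 6 * d * (L : ℝ) ^ 2 * c.M * α₀)) * KZ d L := mul_le_mul_of_nonneg_left hK2 h0
    have h2 : (L : ℝ) * (5 * (d : ℝ) * L * B₀ * ((L : ℝ) ^ 3 * α₀ + 6 * d * (L : ℝ) ^ 2 * c.M * α₀)) * KZ d L ≤
        (d : ℝ) * ((L : ℝ) * (5 * (d : ℝ) * L * B₀ * ((L : ℝ) ^ 3 * α₀ + 6 * d * (L : ℝ) ^ 2 * c.M * α₀)) * KZ d L) :=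
      le_mul_of_one_le_left (by positivity) hdr
    linarith only [hsc, h1, h2]
  have hKZ0 : 0 ≤ KZ d L := by unfold KZ; have := gZ_nonneg d L; positivity
  have hgZ := gZ_nonneg d L
  have hsmallγ : Real.exp (4 * cZ d * ((L : ℝ) ^ 2 * ((L : ℝ) ^ 3 * α₀)))
      * (1 + 2 * (131072 * ((d : ℝ) + 1) ^ 2) * (KZ d L) ^ 2 * ((L : ℝ) * (5 * (d : ℝ) * L * B₀ * ((L : ℝ) ^ 3 * α₀ + 6 * d * (L : ℝ) ^ 2 * c.M * α₀)))) ≤ 2 := by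
    refine le_trans (mul_le_mul_of_nonneg_left ?_ (Real.exp_pos _).le) g9
    have h := mul_le_mul_of_nonneg_left hLcsw (show (0 : ℝ) ≤ 2 * (131072 * ((d : ℝ) + 1) ^ 2) * (KZ d L) ^ 2 by positivity)
    linarith only [h]
  have hc₃γ : KZ d L * ((L : ℝ) * (5 * (d : ℝ) * L * B₀ * ((L : ℝ) ^ 3 * α₀ + 6 * d * (L : ℝ) ^ 2 * c.M * α₀))) ≤ c3 d L :=
    (mul_le_mul_of_nonneg_left hLcsw hKZ0).trans g10
  have h61γ : 2 * (5 * (d : ℝ) * L * B₀ * ((L : ℝ) ^ 3 * α₀ + 6 * d * (L : ℝ) ^ 2 * c.M * α₀)) ^ 2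
      + 20 * d * ((L : ℝ) ^ 3 * α₀) * (5 * (d : ℝ) * L * B₀ * ((L : ℝ) ^ 3 * α₀ + 6 * d * (L : ℝ) ^ 2 * c.M * α₀))
      + 2 * (2 * ((1 + 2 * gZ d L) * (2 * (131072 * ((d : ℝ) + 1) ^ 2) * (KZ d L) ^ 2)) * (L : ℝ) ^ 2) * (5 * (d : ℝ) * L * B₀ * ((L : ℝ) ^ 3 * α₀ + 6 * d * (L : ℝ) ^ 2 * c.M * α₀)) ^ 2
      ≤ (L : ℝ) ^ 3 * α₀ + 6 * d * (L : ℝ) ^ 2 * c.M * α₀ := by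
    have hsq : (5 * (d : ℝ) * L * B₀ * ((L : ℝ) ^ 3 * α₀ + 6 * d * (L : ℝ) ^ 2 * c.M * α₀)) ^ 2 ≤
        (2 * (L * (5 * (d : ℝ) * L * B₀ * ((L : ℝ) ^ 3 * α₀ + 6 * d * (L : ℝ) ^ 2 * c.M * α₀)))
          + 8 * (8 * B₀' * (5 * (d : ℝ) * L * B₀) * ((L : ℝ) ^ 3 * α₀ + 6 * d * (L : ℝ) ^ 2 * c.M * α₀))) ^ 2 :=
      pow_le_pow_left₀ hcs0 hcsw 2
    have hlin : 20 * d * ((L : ℝ) ^ 3 * α₀) * (5 * (d : ℝ) * L * B₀ * ((L : ℝ) ^ 3 * α₀ + 6 * d * (L : ℝ) ^ 2 * c.M * α₀)) ≤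
        20 * d * ((L : ℝ) ^ 3 * α₀) * (2 * (L * (5 * (d : ℝ) * L * B₀ * ((L : ℝ) ^ 3 * α₀ + 6 * d * (L : ℝ) ^ 2 * c.M * α₀)))
          + 8 * (8 * B₀' * (5 * (d : ℝ) * L * B₀) * ((L : ℝ) ^ 3 * α₀ + 6 * d * (L : ℝ) ^ 2 * c.M * α₀))) :=
      mul_le_mul_of_nonneg_left hcsw (by positivity)
    have hK0 : (0 : ℝ) ≤ 2 * (2 * ((1 + 2 * gZ d L) * (2 * (131072 * ((d : ℝ) + 1) ^ 2) * (KZ d L) ^ 2)) * (L : ℝ) ^ 2) := by positivity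
    have hsq' := mul_le_mul_of_nonneg_left hsq hK0
    linarith only [g14, hsq, hlin, hsq']
  -- the member's geometry (edition γ: the split print class `cubeLamBP'`, box law «box ⊂ □_{j−1}», inner ∕ crossing ∕ mirrored trichotomy)
  have hΩc := hΩ_sq c hLo
  have hboxc := lamBPT_hbox_pred c hLs
  have hclassc := lamBPT_hclass c hLs
  have htw := htw_lamST c hLo
  have h8lt := h8lt_lamST c hLo
  have h8top := h8top_lamST c hLo
  refine P6 η hη c U₀ hU₀ α₀ hα hα3 hα2 hA hsmall hc0 ?_ ?_ H59
  · -- `P5base₁`: the base body at `U₀ = 1` + the plain-currency bridge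
    refine hP5base_of_HFP hd2 hη L hone hmem hs84 hcs12 ha ha2 c.sq c.lamST h66
      fun A hdat => ?_
    classical
    obtain ⟨S, hS⟩ : ∃ S : Finset (Site d), ∀ x, x ∈ S ↔ x ∈ c.sq 0 :=
      ⟨(sq_zero_finite c hLo).toFinset, fun x => Set.Finite.mem_toFinset _⟩
    obtain ⟨B, hB'⟩ := exists_towerFinset 1 (c.lamST 1) (fun j _ => lamST_finite c hLo 1 j)
    obtain ⟨rG, rH, rR⟩ := REAL 1 le_rfl hk S hS B hB' _ (fun _ _ => rfl) _ rfl _ rfl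
    obtain ⟨g, Δ, q, qs, Aw, cL, H', g_rightΩ, c_range, hΔ, hqs, hq, hH0, hH1, hH2, hHsupp, hHequiv, hQH, hG, hGsupp, hGreal, hRbd,
      hRreal⟩ := flatLettersZRD_of_real (𝔸 := 𝔸) hd0 hη hLo 1 c.sq
        (fun j _ => sq_subset_zero c hLo j) (c.lamST 1) w hw S hS (tower_meets_dented c hLo hk)
        (towers_disjoint_dented c hLo hk) B hB' _ (fun _ _ => rfl) _ rfl _ rfl rG rH rR
    exact sockHFP₀_body_of_join_RD hd2 hLs hs1 hη hk hΩc (htw 1 hk) hα₀' hα₁' hB₀ hB₀' rfl rfl hone h33 h34 hAx hdat g Δ q qs Aw cL g_rightΩ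
      c_range hΔ hqs hq H' hB₀'H hB₂' hBG hBR hH0 hH1 hH2 hHsupp hHequiv hQH hG hGsupp hGreal hRbd hRreal le_rfl le_rfl le_rfl hα3'
      hα4' hsmallW hc₃ hsc hα₃' hs₁ hs₂ hs₃ hs₄ hs₅ hs₆ hs₇ hsm hprod8 rfl rfl rfl rfl hcA' ha₁' hb₁' hθ h103 h106
  · -- `P5step₁`: the step body at `U₀ = 1` with its (1.59) clause read off `H59₁` + the plain-currency bridge
    refine hP5_of_HFP hd2 hη L c.k hone hs84 hcs12 c.sq c.lamST
      fun m hm1 hmk u₁ U₁ A hu₁ hu₁S hW h129 hLan hdat => ?_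
    classical
    obtain ⟨S, hS⟩ : ∃ S : Finset (Site d), ∀ x, x ∈ S ↔ x ∈ c.sq 0 :=
      ⟨(sq_zero_finite c hLo).toFinset, fun x => Set.Finite.mem_toFinset _⟩
    obtain ⟨B, hB'⟩ := exists_towerFinset (m + 1) (c.lamST (m + 1)) (fun j _ => lamST_finite c hLo (m + 1) j)
    obtain ⟨rG, rH, rR⟩ := REAL (m + 1) (by omega) hmk S hS B hB' _ (fun _ _ => rfl) _ rfl _ rfl
    obtain ⟨g, Δ, q, qs, Aw, cL, H', g_rightΩ, c_range, hΔ, hqs, hq, hH0, hH1, hH2, hHsupp, hHequiv, hQH, hG, hGsupp, hGreal, hRbd,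
      hRreal⟩ := flatLettersZRD_of_real (𝔸 := 𝔸) hd0 hη hLo (m + 1) c.sq
        (fun j _ => sq_subset_zero c hLo j) (c.lamST (m + 1)) w hw S hS (tower_meets_dented c hLo hmk)
        (towers_disjoint_dented c hLo hmk) B hB' _ (fun _ _ => rfl) _ rfl _ rfl rG rH rR
    have hcDAlo : (d : ℝ) * (L : ℝ) ^ 2 * (5 * (d : ℝ) * L * B₀ * ((L : ℝ) ^ 3 * α₀ + 6 * d * (L : ℝ) ^ 2 * c.M * α₀)) ≤
        2 * (d : ℝ) * (L : ℝ) ^ 2 * (5 * (d : ℝ) * L * B₀ * ((L : ℝ) ^ 3 * α₀ + 6 * d * (L : ℝ) ^ 2 * c.M * α₀)) := by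
      have h := mul_nonneg (by positivity : (0 : ℝ) ≤ (d : ℝ) * (L : ℝ) ^ 2) hcs0
      linarith only [h]
    -- Theorem 4's two-member (1.59) clause WITH THE EXTERIOR-COLLAR ALLOWANCE for this datum, from `H59D₁` (allowance `c⋆ ≤ 2Lc⋆ + 8α₄`)
    have H59Dβm : ∀ A' : Site d → Fin d → 𝔸, (∀ y τ, IsSelfAdjoint (A' y τ)) →
        (∀ j, j ≤ m → ∀ (y : Site d) (τ : Fin d), SideTouches (c.sq j) y τ →
          U₁ y τ = cfgExp η A' y τ ∧
            ‖A' y τ‖ ≤ (5 * (d : ℝ) * L * B₀ * ((L : ℝ) ^ 3 * α₀ + 6 * d * (L : ℝ) ^ 2 * c.M * α₀)) * ((L : ℝ) ^ j * η)⁻¹) →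
        (∀ (y : Site d) (τ : Fin d), (∀ j, j ≤ m → ¬ SideTouches (c.sq j) y τ) → A' y τ = 0) →
        msup L m η (-(1 : ℝ)) (fun j (b : Site d × Fin d) => SideTouches (c.sq j) b.1 b.2) (fun b => A' b.1 b.2)
            ≤ B₀ * (bondNorm L m η (-(3 : ℝ)) c.sq (fun x μ => Jcur η (1 : Site d → Fin d → 𝔸ˣ) A' μ x)
              + wsup 1 (fun p : {p : ℕ × (Site d × Fin d) // p.1 ≤ m ∧ (p.2 ∈ c.lamBPT m p.1 ∨ (p.1 = 0 ∧ CrossB (c.sq 0) p.2))} =>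
                  linCovIterZ L (1 : Site d → Fin d → 𝔸ˣ) (iEta η A') p.1.1 p.1.2.1 p.1.2.2))
              + Bbd * msup L m η (-(1 : ℝ)) (fun j (b : Site d × Fin d) => j = 0 ∧ SideTouches (c.sq 0) b.1 b.2 ∧
                  ¬ BondTouches (c.sq 0) b.1 b.2) (fun b => A' b.1 b.2) ∧
          msup L m η (-(2 : ℝ)) (fun j (t : Fin d × Fin d × Site d) => SideTouches (c.sq j) t.2.2 t.2.1)
              (fun t => covDerivFwd η (1 : Site d → Fin d → 𝔸ˣ) t.1 (fun z => A' z t.2.1) t.2.2)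
            ≤ B₀ * (bondNorm L m η (-(3 : ℝ)) c.sq (fun x μ => Jcur η (1 : Site d → Fin d → 𝔸ˣ) A' μ x)
              + wsup 1 (fun p : {p : ℕ × (Site d × Fin d) // p.1 ≤ m ∧ (p.2 ∈ c.lamBPT m p.1 ∨ (p.1 = 0 ∧ CrossB (c.sq 0) p.2))} =>
                  linCovIterZ L (1 : Site d → Fin d → 𝔸ˣ) (iEta η A') p.1.1 p.1.2.1 p.1.2.2))
              + Bbd * msup L m η (-(1 : ℝ)) (fun j (b : Site d × Fin d) => j = 0 ∧ SideTouches (c.sq 0) b.1 b.2 ∧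
                  ¬ BondTouches (c.sq 0) b.1 b.2) (fun b => A' b.1 b.2) := by
      intro A' hsa hWA hA0
      refine H59 m hm1 hmk.le u₁ U₁ A' hu₁ hu₁S hW h129 hLan hsa (fun j hj y τ hs => ⟨(hWA j hj y τ hs).1, (hWA j hj y τ hs).2.trans ?_⟩)
        hA0
      have hw0 : 0 ≤ ((L : ℝ) ^ j * η)⁻¹ := by positivity
      refine mul_le_mul_of_nonneg_right ?_ hw0
      have h1 : 5 * (d : ℝ) * L * B₀ * ((L : ℝ) ^ 3 * α₀ + 6 * d * (L : ℝ) ^ 2 * c.M * α₀) ≤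
          L * (5 * (d : ℝ) * L * B₀ * ((L : ℝ) ^ 3 * α₀ + 6 * d * (L : ℝ) ^ 2 * c.M * α₀)) := le_mul_of_one_le_left hcs0 hLr
      linarith only [h1, hcs0, hα₄0]
    exact sockHFP_body_of_join_59_γ hd2 hLs hs1 hη hΩc hboxc hclassc hm1 hmk (htw (m + 1) hmk) (h8lt m hmk) (h8top m hmk) hα₀' hα₁' hB₀
      hB₀' rfl rfl hone hmem h33 h34 hAx h135 h66 (bdryLayer_dented c hLs hs1) hBbd hBd hu₁ hu₁S hW h129 hLan hdat H59Dβm hside g13 h61γ hsmall₁ g5 g6 h16γ hsmallγ hc₃γ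
      g Δ q qs Aw cL g_rightΩ c_range hΔ hqs hq
      H' hB₀'H hB₂' hBG hBR hH0 hH1 hH2 hHsupp hHequiv hQH hG hGsupp hGreal hRbd hRreal le_rfl le_rfl hcDAlo hα3' hα4' hsmallW hc₃
      hsc hα₃' hs₁ hs₂ hs₃ hs₄ hs₅ hs₆ hs₇ hsm hprod8 rfl rfl rfl rfl hcA' ha₁' hb₁' hθ h103 h106


open Classical in
/-- ★★ **PROPOSITION 6 (p. 99), EXISTENCE HALF, AT THE DENTED CUBE MEMBER (`CubeB8D`, [15] (148)–(150)) FROM THREE REAL INEQUALITY FAMILIES AND THE SCALAR FLAT (1.59) γ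
CLAUSE WITH EXTERIOR DATA.**  `prop6_dentedMember_flat_of_real_γ` with its gauge-field hypothesis `H59Dβ₁` replaced by the SCALAR flat two-line clause at every
truncation over the split print class (`B8Ineq159FlatOfScalarBdryBeta.flat159_clause_of_scalar_bdryβ`, the class-parametric `⊗ id` transfer, at `Λb := cubeLamBP'
… m`): NO gauge-field hypothesis remains — three REAL families on the explicit flat Dirichlet matrices + the scalar γ clauses ([4] Thm 3.3 at `U = 1`, a-priori
form, abelian, print's class; per-cube inhabitant dag-n05-w3 p585691).
[cite: Balaban1985RegularSpaces, Prop. 6 p.99, Thm 4 p.88, Prop. 5 pp.93–94, (1.59) p.86, (1.31) p.82; Balaban1985BackgroundPropagators, Thms 3.1–3.3 pp.397–399, p.394 («⊗ identity»)] -/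
theorem prop6_dentedMember_flat_of_scalar_γ (hd2 : 2 ≤ d) {L sL : ℕ} (hLs : L = 2 * sL + 1) (hs1 : 1 ≤ sL) {B₀ B₀' B₀'H B₂' BG BR : ℝ} (hB₀ : 0 < B₀) (hB₀' : 0 < B₀')
    (hB : 2 ≤ 5 * (d : ℝ) * L * B₀) (hB₀'H : 0 < B₀'H) (hB₂' : 0 ≤ B₂') (hBG : 0 ≤ BG) (hBR : 0 ≤ BR)
    (hfree : 3 * (2 * (d : ℝ) * (L : ℝ) ^ 2) * BG * BR ≤ B₀') {Bbd : ℝ} (hBbd : 0 ≤ Bbd) (hBd : 4 * Bbd ≤ ((d : ℝ) * L - 1) * B₀) :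
    ∃ c₁ : ℝ, 0 < c₁ ∧ ∀ (η : ℝ), 0 < η → ∀ {K : ℕ} {Ω : ℕ → Set (Site d)} (c : CubeB8DZ d L K Ω),
      ∀ (U₀ : Site d → Fin d → 𝔸ˣ), (∀ x κ, U₀ x κ ∈ unitaryUnits 𝔸) → ∀ (α₀ : ℝ), 0 < α₀ →
      C0Z d * (α₀ * (L : ℝ) ^ 2) ≤ 1 / 3 → 2 * (α₀ * (L : ℝ) ^ 2) ≤ c2' d L →
      InAk L c.k η α₀ Ω U₀ →
      11 * (d : ℝ) ^ 2 * (L : ℝ) ^ 2 * α₀ + ((c.M : ℝ) + 4 * c.ρ) * d * (L : ℝ) ^ 2 * α₀ ≤ 1 / 6 →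
      (L : ℝ) ^ 3 * α₀ + 6 * d * (L : ℝ) ^ 2 * c.M * α₀ ≤ c₁ →
      -- the weights of `Q′ᵀaQ′` (free, nonnegative) and THE THREE REAL INEQUALITY FAMILIES at every truncation `n ≤ k` on the explicit matrices,
      -- CENTRED labels `flmZ` (g38's `B8Real123FlatTranslateRec.Real123Block`)
      ∀ (w : ℕ → ℝ), (∀ j, 0 ≤ w j) →
      (∀ n, 1 ≤ n → n ≤ c.k → Real123Block L (flmZ L) η n w c.sq (c.lamST n) BG B₀'H B₂' BR) →
      -- THE SCALAR FLAT (1.59) CLAUSE WITH THE EXTERIOR-COLLAR ALLOWANCE at every truncation `m ≤ k`: ℂ-valued bond functions in the flat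
      -- Landau gauge on the collars of `{□_j}` ([4] Thm 3.3 at `U = 1` for `G(1)` on the finite cube WITH exterior data, a-priori form, abelian)
      (∀ m, 1 ≤ m → m ≤ c.k → ∀ φ : Site d → Fin d → ℂ,
        IsLandau138Z L m η (c.sq 0) (c.lamST m) (1 : Site d → Fin d → ℂˣ) φ →
        (∀ (y : Site d) (τ : Fin d), (∀ j, j ≤ m → ¬ SideTouches (c.sq j) y τ) → φ y τ = 0) →
        msup L m η (-(1 : ℝ)) (fun j (b : Site d × Fin d) => SideTouches (c.sq j) b.1 b.2) (fun b => φ b.1 b.2)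
          ≤ B₀ * (bondNorm L m η (-(3 : ℝ)) c.sq (fun x μ => Jcur η (1 : Site d → Fin d → ℂˣ) φ μ x)
            + wsup 1 (fun p : {p : ℕ × (Site d × Fin d) // p.1 ≤ m ∧ (p.2 ∈ c.lamBPT m p.1 ∨ (p.1 = 0 ∧ CrossB (c.sq 0) p.2))} =>
                linCovIterZ L (1 : Site d → Fin d → ℂˣ) (iEta η φ) p.1.1 p.1.2.1 p.1.2.2))
            + Bbd * msup L m η (-(1 : ℝ)) (fun j (b : Site d × Fin d) => j = 0 ∧ SideTouches (c.sq 0) b.1 b.2 ∧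
                ¬ BondTouches (c.sq 0) b.1 b.2) (fun b => φ b.1 b.2) ∧
        msup L m η (-(2 : ℝ)) (fun j (t : Fin d × Fin d × Site d) => SideTouches (c.sq j) t.2.2 t.2.1)
            (fun t => covDerivFwd η (1 : Site d → Fin d → ℂˣ) t.1 (fun z => φ z t.2.1) t.2.2)
          ≤ B₀ * (bondNorm L m η (-(3 : ℝ)) c.sq (fun x μ => Jcur η (1 : Site d → Fin d → ℂˣ) φ μ x)
            + wsup 1 (fun p : {p : ℕ × (Site d × Fin d) // p.1 ≤ m ∧ (p.2 ∈ c.lamBPT m p.1 ∨ (p.1 = 0 ∧ CrossB (c.sq 0) p.2))} =>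
                linCovIterZ L (1 : Site d → Fin d → ℂˣ) (iEta η φ) p.1.1 p.1.2.1 p.1.2.2))
            + Bbd * msup L m η (-(1 : ℝ)) (fun j (b : Site d × Fin d) => j = 0 ∧ SideTouches (c.sq 0) b.1 b.2 ∧
                ¬ BondTouches (c.sq 0) b.1 b.2) (fun b => φ b.1 b.2)) →
      ∃ u : Site d → 𝔸ˣ, (∀ x, u x ∈ unitaryUnits 𝔸) ∧ (∀ x, x ∉ c.sq 0 → u x = 1) ∧
        Restr129Z L c.k c.lamS (1 : Site d → Fin d → 𝔸ˣ) u ∧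
        IsLandau138WZ L c.k η (c.sq 0) c.lamS (1 : Site d → Fin d → 𝔸ˣ)
          (gaugeAct u⁻¹ (cutFixedZ L (tLo c.a c.ρ) (tHi c.a c.M c.ρ) U₀ c.k (ctr c.a c.M))) ∧
        (∀ j, j ≤ c.k → ∀ b ∈ {b : Site d × Fin d | SideTouches (c.sq j) b.1 b.2},
          gaugeAct u⁻¹ (cutFixedZ L (tLo c.a c.ρ) (tHi c.a c.M c.ρ) U₀ c.k (ctr c.a c.M)) b.1 b.2 =
              cfgExp η (logCfg η (gaugeAct u⁻¹ (cutFixedZ L (tLo c.a c.ρ) (tHi c.a c.M c.ρ) U₀ c.k (ctr c.a c.M)))) b.1 b.2 ∧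
            IsSelfAdjoint (logCfg η (gaugeAct u⁻¹ (cutFixedZ L (tLo c.a c.ρ) (tHi c.a c.M c.ρ) U₀ c.k (ctr c.a c.M))) b.1 b.2) ∧
            ‖logCfg η (gaugeAct u⁻¹ (cutFixedZ L (tLo c.a c.ρ) (tHi c.a c.M c.ρ) U₀ c.k (ctr c.a c.M))) b.1 b.2‖ ≤
              (5 * (d : ℝ) * L * B₀ * ((L : ℝ) ^ 3 * α₀ + 6 * d * (L : ℝ) ^ 2 * c.M * α₀)) * ((L : ℝ) ^ j * η)⁻¹) ∧
        (∀ x, ((localGaugeZ L (tLo c.a c.ρ) (tHi c.a c.M c.ρ) U₀ c.k (ctr c.a c.M))⁻¹ * u) x ∈ unitaryUnits 𝔸) ∧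
        AgreeOn (tlo L (tLo c.a c.ρ) c.k) (thi L (tHi c.a c.M c.ρ) c.k)
          (gaugeAct ((localGaugeZ L (tLo c.a c.ρ) (tHi c.a c.M c.ρ) U₀ c.k (ctr c.a c.M))⁻¹ * u)⁻¹ U₀)
          (gaugeAct u⁻¹ (cutFixedZ L (tLo c.a c.ρ) (tHi c.a c.M c.ρ) U₀ c.k (ctr c.a c.M))) := by
  have hL1 : 1 ≤ L := by omega
  have hLpos : (0 : ℝ) < L := by exact_mod_cast (lt_of_lt_of_le (by norm_num) hL1)
  have hdpos : (0 : ℝ) < d := by exact_mod_cast (lt_of_lt_of_le (by norm_num) hd2 : 0 < d)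
  obtain ⟨c₁, hc₁, H⟩ := prop6_dentedMember_flat_of_real_γ (𝔸 := 𝔸) hd2 hLs hs1 hB₀ hB₀' hB hB₀'H hB₂' hBG hBR hfree hBbd hBd
  -- the allowance of the step datum's exponents is `Kc·(L³α₀ + 6dL²Mα₀)`; below `1/(2Kc)` it is `≤ 1/2`, as the `⊗ id` transfer wants
  set Kc : ℝ := 2 * (L * (5 * (d : ℝ) * L * B₀)) + 8 * (8 * B₀' * (5 * (d : ℝ) * L * B₀)) with hKc_def
  have hKc : 0 < Kc := by positivity
  refine ⟨min c₁ (1 / (2 * Kc)), lt_min hc₁ (by positivity), ?_⟩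
  intro η hη K Ω c U₀ hU₀ α₀ hα hα3 hα2 hA hsmall hc w hw REAL SCALAR
  have hc1 : (L : ℝ) ^ 3 * α₀ + 6 * d * (L : ℝ) ^ 2 * c.M * α₀ ≤ c₁ := hc.trans (min_le_left _ _)
  have hcK : (L : ℝ) ^ 3 * α₀ + 6 * d * (L : ℝ) ^ 2 * c.M * α₀ ≤ 1 / (2 * Kc) := hc.trans (min_le_right _ _)
  have hs0 : 0 ≤ (L : ℝ) ^ 3 * α₀ + 6 * d * (L : ℝ) ^ 2 * c.M * α₀ := by positivity
  -- the allowance `c` of `H59D₁` and its window `0 ≤ c ≤ 1/2`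
  have hcoef : 2 * (L * (5 * (d : ℝ) * L * B₀ * (((L : ℝ) ^ 3 * α₀) + (6 * d * (L : ℝ) ^ 2 * c.M * α₀)))) +
      8 * (8 * B₀' * (5 * (d : ℝ) * L * B₀) * (((L : ℝ) ^ 3 * α₀) + (6 * d * (L : ℝ) ^ 2 * c.M * α₀))) =
      Kc * ((L : ℝ) ^ 3 * α₀ + 6 * d * (L : ℝ) ^ 2 * c.M * α₀) := by rw [hKc_def]; ring
  have hc0 : 0 ≤ 2 * (L * (5 * (d : ℝ) * L * B₀ * (((L : ℝ) ^ 3 * α₀) + (6 * d * (L : ℝ) ^ 2 * c.M * α₀)))) +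
      8 * (8 * B₀' * (5 * (d : ℝ) * L * B₀) * (((L : ℝ) ^ 3 * α₀) + (6 * d * (L : ℝ) ^ 2 * c.M * α₀))) := by
    rw [hcoef]; positivity
  have hchalf : 2 * (L * (5 * (d : ℝ) * L * B₀ * (((L : ℝ) ^ 3 * α₀) + (6 * d * (L : ℝ) ^ 2 * c.M * α₀)))) +
      8 * (8 * B₀' * (5 * (d : ℝ) * L * B₀) * (((L : ℝ) ^ 3 * α₀) + (6 * d * (L : ℝ) ^ 2 * c.M * α₀))) ≤ 1 / 2 := by
    rw [hcoef]
    calc Kc * ((L : ℝ) ^ 3 * α₀ + 6 * d * (L : ℝ) ^ 2 * c.M * α₀) ≤ Kc * (1 / (2 * Kc)) := mul_le_mul_of_nonneg_left hcK hKc.le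
      _ = 1 / 2 := by field_simp
  -- `H59D₁` from the scalar clause by the `⊗ id` transfer in the repaired currency, at every truncation
  refine H η hη c U₀ hU₀ α₀ hα hα3 hα2 hA hsmall hc1 w hw REAL ?_
  intro m hm1 hmk u W A' hu huS hW h129 hLan hsa hWA hA0
  exact flat159Z_clause_of_scalar_bdryβ hd2 hLs hη m c.sq (c.lamST m) (c.lamBPT m) hB₀.le
    hBbd hc0 hchalf (SCALAR m hm1 hmk) W A' hLan hWA hA0

end Literature.MathematicalPhysics.QuantumFieldTheory.Balaban1983to89.B8Prop6DentedCubeMemberFlatScalarGammaRec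

end
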